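import Literature.NumberTheory.Transcendental.PadicSmallJetsSchwarz
import HarnessLib

/-!
# The small-jets Schwarz lemma with a LEVEL structure on the nodes (sharp ultrametric conditioning)

Sequel to `PadicSmallJetsSchwarz.lean` (proved theorems only; no named fact). There the
generalised divided differences over `δ`-separated nodes with `ε`-small jets were bounded by
`ε δ^{-N}` (`N` = order) — the worst case in which every division is by the smallest distance `δ`.
For nodes in an ultrametric field this is far from the truth: most pairs of nodes are FAR apart.
Here the nodes carry a level structure — radii `1 = R₀ ≥ R₁ ≥ ⋯`, every distance between distinct
nodes being EXACTLY some `R_j` with `j < J` (for integer nodes in `ℚ_p`: `R_j = p^{-j}`) — and the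
divided differences are taken GREEDILY (always divide by the LARGEST available distance; the order
is immaterial by `ddList_perm`). If at some step the largest distance from the evaluation point is
`R_{j₀}`, then all remaining nodes lie in the ball of radius `R_{j₀}`, which is then never left
(ultrametric), so the number of divisions by a distance `≤ R_j` is at most the largest number
`m_j` of nodes (with multiplicity) in a ball of radius `R_j`:

* `norm_gdd_le_levels` — `‖G_{ddList ys b}(y)‖ ≤ ε ∏_{j<J} (R_j/R_{j+1})^{m_{j+1}(ys)}`;
* `norm_tsum_le_max_of_small_jets_levels` — the Schwarz lemma with this conditioning factor in
  place of `δ^{-(N-1)}`.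

For `kpts` consecutive odd integers of multiplicity `t` in `ℚ_p` this gives the conditioning
`p^{t (kpts/(p-1) + log_p(2 kpts) + 1)}` instead of `(2 kpts)^{kpts t}` (`PadicCW77KStep.lean`).

## References
* Kunrui Yu, *Linear forms in p-adic logarithms II*, Compositio Math. 74 (1990), Lemma 1.2 and
  §3 (the `p`-adic interpolation on integer points).
* A. M. Robert, *A Course in p-adic Analysis*, GTM 198 (2000), Ch. 6 §2.
-/

noncomputable section

open Filter Topology IsUltrametricDist Finset

namespace Literature.NumberTheory.Transcendental

namespace PadicNewton

variable {K : Type*} [NontriviallyNormedField K] [IsUltrametricDist K] [CompleteSpace K]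

/-- The largest number of elements of the list `ys` (with multiplicity) in a closed ball of radius
`Rj` centred at a node. [cite: Yu1990, Lemma 1.2] -/
def ballCount (nodes : Finset K) (Rj : ℝ) (ys : List K) : ℕ :=
  nodes.sup fun a => ys.countP fun x => decide (‖x - a‖ ≤ Rj)

omit [IsUltrametricDist K] [CompleteSpace K] in
/-- `ballCount` is monotone along sublists. [cite: Yu1990, Lemma 1.2] -/
theorem ballCount_mono_sublist (nodes : Finset K) (Rj : ℝ) {ys ys' : List K}
    (h : ys'.Sublist ys) : ballCount nodes Rj ys' ≤ ballCount nodes Rj ys := by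
  unfold ballCount
  exact Finset.sup_mono_fun fun a _ => h.countP_le

omit [IsUltrametricDist K] [CompleteSpace K] in
/-- `ballCount` is invariant under permutations. [cite: Yu1990, Lemma 1.2] -/
theorem ballCount_perm (nodes : Finset K) (Rj : ℝ) {ys ys' : List K} (h : ys.Perm ys') :
    ballCount nodes Rj ys = ballCount nodes Rj ys' := by
  unfold ballCount
  exact Finset.sup_congr rfl fun a _ => h.countP_eq _

omit [IsUltrametricDist K] [CompleteSpace K] in
/-- If the whole list lies in the ball of radius `Rj` about the node `y`, then `ballCount ≥ |ys|`.
[cite: Yu1990, Lemma 1.2] -/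
theorem length_le_ballCount {nodes : Finset K} {Rj : ℝ} {ys : List K} {y : K} (hy : y ∈ nodes)
    (hall : ∀ x ∈ ys, ‖x - y‖ ≤ Rj) : ys.length ≤ ballCount nodes Rj ys := by
  unfold ballCount
  have h1 : ys.countP (fun x => decide (‖x - y‖ ≤ Rj)) = ys.length :=
    List.countP_eq_length.mpr (by intro x hx; simpa using hall x hx)
  calc ys.length = ys.countP (fun x => decide (‖x - y‖ ≤ Rj)) := h1.symm
    _ ≤ nodes.sup fun a => ys.countP fun x => decide (‖x - a‖ ≤ Rj) :=
        Finset.le_sup (f := fun a => ys.countP fun x => decide (‖x - a‖ ≤ Rj)) hy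

omit [IsUltrametricDist K] [CompleteSpace K] in
/-- `ballCount ≤ |ys|`. [cite: Yu1990, Lemma 1.2] -/
theorem ballCount_le_length (nodes : Finset K) (Rj : ℝ) (ys : List K) :
    ballCount nodes Rj ys ≤ ys.length := by
  unfold ballCount
  exact Finset.sup_le fun a _ => List.countP_le_length

omit [IsUltrametricDist K] [CompleteSpace K] in
/-- Telescoping: `∏_{j<n} (R j / R (j+1)) = R 0 / R n` for positive `R`. [cite: Yu1990, Lemma 1.2] -/
theorem prod_range_ratio (R : ℕ → ℝ) (hR : ∀ j, 0 < R j) (n : ℕ) :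
    ∏ j ∈ range n, R j / R (j + 1) = R 0 / R n := by
  induction n with
  | zero => simp [(hR 0).ne']
  | succ n ih =>
    rw [Finset.prod_range_succ, ih]
    field_simp [(hR n).ne', (hR (n+1)).ne', (hR 0).ne']

/-- **Small jets give small generalised divided differences — level version.** Let the distances
between distinct nodes be exact levels `R_j`, `j < J` (`1 = R₀ ≥ R₁ ≥ ⋯ > 0`), and let the jets of
order `< T` of `G_b` at the nodes be `≤ ε`. Then for every node sequence `ys` and node `y` with
`y :: ys` using each node at most `T` times,
`‖G_{ddList ys b}(y)‖ ≤ ε · ∏_{j<J} (R_j/R_{j+1})^{ballCount R_{j+1} ys}`.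
[cite: Yu1990, Lemma 1.2] -/
theorem norm_gdd_le_levels [DecidableEq K] {ρ B r ε : ℝ} (hρ : 0 < ρ) (hr : r < ρ) {b : ℕ → K}
    (hb : WtBdd ρ B b) (nodes : Finset K) (hnod : ∀ a ∈ nodes, ‖a‖ ≤ r)
    (R : ℕ → ℝ) (hR0 : R 0 = 1) (hRpos : ∀ j, 0 < R j) (hRanti : ∀ j, R (j + 1) ≤ R j) (J : ℕ)
    (hlev : ∀ a ∈ nodes, ∀ a' ∈ nodes, a ≠ a' → ∃ j < J, ‖a - a'‖ = R j)
    {T : ℕ} (hε : 0 ≤ ε)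
    (hjet : ∀ a ∈ nodes, ∀ k < T, ‖∑' n, ddList (List.replicate k a) b n * a ^ n‖ ≤ ε) :
    ∀ (ys : List K) (y : K), y ∈ nodes → (∀ x ∈ ys, x ∈ nodes) →
      (∀ a ∈ nodes, (y :: ys).count a ≤ T) →
        ‖∑' n, ddList ys b n * y ^ n‖ ≤
          ε * ∏ j ∈ range J, (R j / R (j + 1)) ^ ballCount nodes (R (j + 1)) ys := by
  classical
  have hratio : ∀ j, 1 ≤ R j / R (j + 1) := fun j =>
    (one_le_div (hRpos _)).mpr (hRanti j)
  -- the conditioning factor is `≥ 1` and monotone in the exponents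
  have hfac_mono : ∀ (e e' : ℕ → ℕ), (∀ j, e j ≤ e' j) →
      ∏ j ∈ range J, (R j / R (j + 1)) ^ e j ≤ ∏ j ∈ range J, (R j / R (j + 1)) ^ e' j :=
    fun e e' h => prod_le_prod (fun j _ => by have := hratio j; positivity)
      fun j _ => pow_le_pow_right₀ (hratio j) (h j)
  have hfac1 : ∀ (e : ℕ → ℕ), 1 ≤ ∏ j ∈ range J, (R j / R (j + 1)) ^ e j := fun e => by
    calc (1 : ℝ) = ∏ _j ∈ range J, (1 : ℝ) := Finset.prod_const_one.symm
      _ ≤ ∏ j ∈ range J, (R j / R (j + 1)) ^ e j :=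
          prod_le_prod (fun _ _ => zero_le_one) fun j _ => one_le_pow₀ (hratio j)
  have hRanti' : ∀ a k, R (a + k) ≤ R a := by
    intro a k
    induction k with
    | zero => simp
    | succ k ih => exact (hRanti (a + k)).trans ih
  suffices hN : ∀ (N : ℕ) (ys : List K) (y : K), ys.length = N → y ∈ nodes →
      (∀ x ∈ ys, x ∈ nodes) → (∀ a ∈ nodes, (y :: ys).count a ≤ T) →
        ‖∑' n, ddList ys b n * y ^ n‖ ≤
          ε * ∏ j ∈ range J, (R j / R (j + 1)) ^ ballCount nodes (R (j + 1)) ys by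
    intro ys y; exact hN ys.length ys y rfl
  intro N
  induction N using Nat.strong_induction_on with
  | _ N IH =>
  intro ys y hlen hy hys hcnt
  have hysr : ∀ x ∈ ys, ‖x‖ ≤ r := fun x hx ↦ hnod x (hys x hx)
  by_cases hall : ∀ x ∈ ys, x = y
  · -- a pure jet
    have hrep : ys = List.replicate ys.length y := List.eq_replicate_iff.mpr ⟨rfl, hall⟩
    have hlt : ys.length < T := by
      have h1 := hcnt y hy
      rw [List.count_cons_self, hrep, List.count_replicate_self] at h1
      omega
    have h2 := hjet y hy ys.length hlt
    rw [← hrep] at h2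
    exact h2.trans (le_mul_of_one_le_right hε (hfac1 _))
  · push Not at hall
    -- greedy choice: `x ∈ ys`, `x ≠ y`, FARTHEST from `y`
    obtain ⟨x, hxmem, hxmax⟩ := Finset.exists_max_image ((ys.toFinset).filter fun x => x ≠ y)
      (fun x => ‖y - x‖) (by
        obtain ⟨x, hx, hxy⟩ := hall
        exact ⟨x, by rw [Finset.mem_filter, List.mem_toFinset]; exact ⟨hx, hxy⟩⟩)
    rw [Finset.mem_filter, List.mem_toFinset] at hxmem
    obtain ⟨hxys, hxy⟩ := hxmem
    set ys' := ys.erase x with hys'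
    have hperm : ys.Perm (ys' ++ [x]) :=
      (List.perm_cons_erase hxys).trans (List.perm_append_singleton x ys').symm
    have hlen' : ys'.length + 1 = ys.length := by
      rw [hys', List.length_erase_of_mem hxys]
      have : 0 < ys.length := List.length_pos_of_mem hxys
      omega
    have hx : x ∈ nodes := hys x hxys
    have hsub' : ∀ x' ∈ ys', x' ∈ ys := fun x' hx' ↦ List.mem_of_mem_erase hx'
    have hsubl : ys'.Sublist ys := List.erase_sublist
    -- the level `j₀` of the largest distance
    obtain ⟨j₀, hj₀J, hj₀⟩ := hlev y hy x hx (Ne.symm hxy)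
    -- every element of `ys` is within `R j₀` of `y`
    have hball : ∀ x' ∈ ys, ‖x' - y‖ ≤ R j₀ := by
      intro x' hx'
      by_cases hx'y : x' = y
      · rw [hx'y, sub_self, norm_zero]; exact (hRpos _).le
      · rw [norm_sub_rev, ← hj₀]
        exact hxmax x' (by rw [Finset.mem_filter, List.mem_toFinset]; exact ⟨hx', hx'y⟩)
    -- `ddList ys b = dd x (ddList ys' b)`
    have hdd : ddList ys b = dd x (ddList ys' b) := by
      rw [ddList_perm hρ hr hperm hb hysr, ddList_append_singleton]
    set g := ddList ys' b with hg
    have hgB : WtBdd ρ (B / ρ ^ ys'.length) g :=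
      wtBdd_ddList hρ hr.le ys' hb (fun x' hx' ↦ hysr x' (hsub' x' hx'))
    have hdiv := tsum_eq_add_sub_mul_tsum_dd hgB hρ hr (hnod x hx) (hnod y hy)
    have hyx : y - x ≠ 0 := sub_ne_zero.mpr (Ne.symm hxy)
    have hquot : ∑' n, dd x g n * y ^ n =
        ((∑' n, g n * y ^ n) - ∑' n, g n * x ^ n) / (y - x) := by
      rw [eq_div_iff hyx]
      linear_combination -hdiv
    -- the two inductive bounds (for `ys'`)
    have hlt : ys'.length < N := by omega
    set F' : ℝ := ∏ j ∈ range J, (R j / R (j + 1)) ^ ballCount nodes (R (j + 1)) ys' with hF'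
    have IHy : ‖∑' n, g n * y ^ n‖ ≤ ε * F' := by
      refine IH _ hlt ys' y rfl hy (fun x' hx' ↦ hys x' (hsub' x' hx')) fun a ha ↦ ?_
      refine le_trans ?_ (hcnt a ha)
      exact (List.erase_sublist.cons_cons y).count_le a
    have IHx : ‖∑' n, g n * x ^ n‖ ≤ ε * F' := by
      refine IH _ hlt ys' x rfl hx (fun x' hx' ↦ hys x' (hsub' x' hx')) fun a ha ↦ ?_
      refine le_trans ?_ (hcnt a ha)
      rw [← (List.perm_cons_erase hxys).count_eq a]
      exact List.count_le_count_cons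
    -- the key count: for `j + 1 ≤ j₀`, `ballCount (R (j+1)) ys' + 1 ≤ ballCount (R (j+1)) ys`
    have hdrop : ∀ j, j < j₀ →
        ballCount nodes (R (j + 1)) ys' + 1 ≤ ballCount nodes (R (j + 1)) ys := by
      intro j hj
      have hRle : R j₀ ≤ R (j + 1) := by
        have := hRanti' (j + 1) (j₀ - (j + 1))
        rwa [Nat.add_sub_cancel' (by omega)] at this
      have h1 : ys.length ≤ ballCount nodes (R (j + 1)) ys :=
        length_le_ballCount hy fun x' hx' => (hball x' hx').trans hRle
      have h2 : ballCount nodes (R (j + 1)) ys' ≤ ys'.length := ballCount_le_length _ _ _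
      omega
    have hmono : ∀ j, ballCount nodes (R (j + 1)) ys' ≤ ballCount nodes (R (j + 1)) ys :=
      fun j => ballCount_mono_sublist _ _ hsubl
    -- `F' / R j₀ ≤ F`
    set F : ℝ := ∏ j ∈ range J, (R j / R (j + 1)) ^ ballCount nodes (R (j + 1)) ys with hF
    have hkey : F' * (1 / R j₀) ≤ F := by
      -- `1 / R j₀ = ∏_{j < j₀} (R j / R (j+1))`
      have htel : (1 : ℝ) / R j₀ = ∏ j ∈ range j₀, R j / R (j + 1) := by
        rw [prod_range_ratio R hRpos, hR0]
      rw [htel, hF', hF]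
      -- split `range J` as `range j₀` and the rest via indicator exponents
      have hsplit : (∏ j ∈ range J, (R j / R (j + 1)) ^ ballCount nodes (R (j + 1)) ys') *
          ∏ j ∈ range j₀, R j / R (j + 1) =
          ∏ j ∈ range J, (R j / R (j + 1)) ^ (ballCount nodes (R (j + 1)) ys' + if j < j₀ then 1 else 0) := by
        have e1 : ∏ j ∈ range j₀, R j / R (j + 1) =
            ∏ j ∈ range J, (R j / R (j + 1)) ^ (if j < j₀ then 1 else 0) := by
          rw [← Finset.prod_filter_mul_prod_filter_not (range J) (fun j => j < j₀)]
          have hfl : (range J).filter (fun j => j < j₀) = range j₀ := by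
            ext j; simp only [Finset.mem_filter, Finset.mem_range]; omega
          rw [hfl]
          have hrest : ∏ j ∈ (range J).filter (fun j => ¬ j < j₀), (R j / R (j + 1)) ^ (if j < j₀ then 1 else 0) = 1 :=
            prod_eq_one fun j hj => by
              rw [Finset.mem_filter] at hj; rw [if_neg hj.2, pow_zero]
          rw [hrest, mul_one]
          exact prod_congr rfl fun j hj => by rw [if_pos (mem_range.mp hj), pow_one]
        rw [e1, ← prod_mul_distrib]
        exact prod_congr rfl fun j _ => by rw [← pow_add]
      rw [hsplit]
      refine hfac_mono _ _ fun j => ?_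
      by_cases hj : j < j₀
      · rw [if_pos hj]; exact hdrop j hj
      · rw [if_neg hj, add_zero]; exact hmono j
    -- assemble
    rw [hdd, hquot, norm_div, div_le_iff₀ (norm_pos_iff.mpr hyx), hj₀]
    calc ‖(∑' n, g n * y ^ n) - ∑' n, g n * x ^ n‖
        ≤ max ‖∑' n, g n * y ^ n‖ ‖∑' n, g n * x ^ n‖ := by
          simpa only [sub_eq_add_neg, norm_neg] using IsUltrametricDist.norm_add_le_max _ (-(∑' n, g n * x ^ n))
      _ ≤ ε * F' := max_le IHy IHx
      _ = ε * (F' * (1 / R j₀)) * R j₀ := by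
          have hRj : R j₀ ≠ 0 := (hRpos j₀).ne'
          field_simp
      _ ≤ ε * F * R j₀ := by
          refine mul_le_mul_of_nonneg_right (mul_le_mul_of_nonneg_left hkey hε) (hRpos _).le

/-- **Ultrametric Schwarz lemma with multiplicities and small jets — level version.** As
`norm_tsum_le_max_of_small_jets`, with the conditioning factor
`∏_{j<J} (R_j/R_{j+1})^{ballCount R_{j+1} xs}` in place of `δ^{-(N-1)}`.
[cite: Yu1990, Lemma 1.2] -/
theorem norm_tsum_le_max_of_small_jets_levels [DecidableEq K] {ρ B r ε : ℝ} (hρ : 0 < ρ)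
    (hr : r < ρ) (hr1 : r ≤ 1) {b : ℕ → K} (hb : WtBdd ρ B b) (nodes : Finset K)
    (hnod : ∀ a ∈ nodes, ‖a‖ ≤ r)
    (R : ℕ → ℝ) (hR0 : R 0 = 1) (hRpos : ∀ j, 0 < R j) (hRanti : ∀ j, R (j + 1) ≤ R j) (J : ℕ)
    (hlev : ∀ a ∈ nodes, ∀ a' ∈ nodes, a ≠ a' → ∃ j < J, ‖a - a'‖ = R j)
    {T : ℕ} (hε : 0 ≤ ε)
    (hjet : ∀ a ∈ nodes, ∀ k < T, ‖∑' n, ddList (List.replicate k a) b n * a ^ n‖ ≤ ε)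
    (xs : List K) (hxs : ∀ x ∈ xs, x ∈ nodes) (hcnt : ∀ a ∈ nodes, xs.count a ≤ T)
    {z : K} (hz : ‖z‖ ≤ r) :
    ‖∑' n, b n * z ^ n‖ ≤
      max (ε * ∏ j ∈ range J, (R j / R (j + 1)) ^ ballCount nodes (R (j + 1)) xs)
        (B / ρ ^ xs.length * (xs.map fun x ↦ ‖z - x‖).prod) := by
  classical
  have hxsr : ∀ x ∈ xs, ‖x‖ ≤ r := fun x hx ↦ hnod x (hxs x hx)
  have hratio : ∀ j, 1 ≤ R j / R (j + 1) := fun j => (one_le_div (hRpos _)).mpr (hRanti j)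
  set C : ℝ := ε * ∏ j ∈ range J, (R j / R (j + 1)) ^ ballCount nodes (R (j + 1)) xs with hC
  have hC0 : 0 ≤ C := by
    rw [hC]; exact mul_nonneg hε (prod_nonneg fun j _ => by have := hratio j; positivity)
  rw [tsum_eq_newtonSum_add hρ hr xs hb hxsr hz]
  refine (IsUltrametricDist.norm_add_le_max _ _).trans (max_le_max ?_ ?_)
  · -- the Newton sum: uniform bound `C` for every prefix (use `norm_newtonSum_le` with `δ = 1`)
    have h := norm_newtonSum_le (K := K) one_pos le_rfl xs (b := b) (ε := C) hC0 ?_ (z := z) ?_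
    · simpa using h
    · intro pre x post hsplit
      have hsub : (pre ++ [x]).Sublist xs := by
        rw [hsplit]; exact (List.Sublist.refl pre).append ((List.nil_sublist post).cons_cons x)
      have hperm : (x :: pre).Perm (pre ++ [x]) := (List.perm_append_singleton x pre).symm
      have hpre : pre.Sublist xs := (List.sublist_append_left pre [x]).trans hsub
      have hgdd := norm_gdd_le_levels hρ hr hb nodes hnod R hR0 hRpos hRanti J hlev hε hjet pre x
        (hxs x (by rw [hsplit]; simp)) (fun y hy ↦ hxs y (by rw [hsplit]; simp [hy])) (by
          intro a ha
          rw [hperm.count_eq a]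
          exact (hsub.count_le a).trans (hcnt a ha))
      rw [inv_one, one_pow, mul_one]
      refine hgdd.trans (mul_le_mul_of_nonneg_left ?_ hε)
      exact prod_le_prod (fun j _ => by have := hratio j; positivity)
        fun j _ => pow_le_pow_right₀ (hratio j) (ballCount_mono_sublist _ _ hpre)
    · intro x hx
      calc ‖z - x‖ ≤ max ‖z‖ ‖x‖ := by
            simpa only [sub_eq_add_neg, norm_neg] using IsUltrametricDist.norm_add_le_max z (-x)
        _ ≤ r := max_le hz (hxsr x hx)
        _ ≤ 1 := hr1
  · have hprod : ∀ l : List K, ‖(l.map fun x ↦ z - x).prod‖ = (l.map fun x ↦ ‖z - x‖).prod := by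
      intro l
      induction l with
      | nil => simp
      | cons x l ih => simp [List.map_cons, List.prod_cons, norm_mul, ih]
    rw [norm_mul, hprod xs, mul_comm]
    exact mul_le_mul_of_nonneg_right
      ((wtBdd_ddList hρ hr.le xs hb hxsr).norm_tsum_le hρ hr.le hz)
      (List.prod_nonneg fun t ht ↦ by
        obtain ⟨x, -, rfl⟩ := List.mem_map.mp ht; exact norm_nonneg _)

end PadicNewton

end Literature.NumberTheory.Transcendental

end
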